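import Literature.AlgebraicGeometry.Limits.RelativeDimensionDescent
import Literature.AlgebraicGeometry.Limits.ClosedSubschemes
import Literature.AlgebraicGeometry.Limits.LocalizationEtaleSpread
import Literature.AlgebraicGeometry.Motives.ProjectiveDescentProperProofs
import HarnessLib

/-!
# Spreading out an embedded family: a closed subscheme of `P₀ ×_{R₀} Spec K`, smooth over
# `Spec C₀ ×_{R₀} Spec K`, comes from a closed subscheme of `P₀ ×_{R₀} Spec T` smooth over
# `Spec C₀ ×_{R₀} Spec T`, for a finitely generated `R₀`-subalgebra `T ⊆ K` (localised)

Topic `Literature/AlgebraicGeometry/Limits` (EGA IV₃ 8.8.2, 8.10.5; IV₄ 17.7.8; Görtz–Wedhorn I,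
Prop. 10.75; the "spreading out" step of reduction modulo `p` for FAMILIES, Maulik–Poonen 2012 §4).
Setting: `R₀` a Noetherian ring, `C₀` an `R₀`-algebra of finite type (the model of a base), `K` a
field over `R₀` (in applications `R₀ ⊆ K` finitely generated over `ℤ` and `K = ℂ`), `P₀` an
`R₀`-scheme of finite type (in applications `ℙᴹ_{C₀}`) with an `R₀`-morphism `p₀ : P₀ → Spec C₀`,
and a closed subscheme `j : X ↪ P₀ ×_{R₀} Spec K` such that `X → Spec C₀ ×_{R₀} Spec K` is smooth
of relative dimension `n` and `Spec C₀ ×_{R₀} Spec K → Spec K` is smooth of relative dimension `d`.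

* `exists_stage_closedSubscheme_smoothOfRelativeDimension` — **there are a finitely generated
  `R₀`-subalgebra of `K`, localised at one element, `T ⊆ K` (a domain of finite type over `R₀`), a
  closed subscheme `Y ↪ P₀ ×_{R₀} Spec T` with `Y → Spec C₀ ×_{R₀} Spec T` smooth of relative
  dimension `n` and `Spec C₀ ×_{R₀} Spec T → Spec T` smooth of relative dimension `d`, and a
  cartesian square exhibiting `X` as the base change of `Y` along
  `P₀ ×_{R₀} Spec K → P₀ ×_{R₀} Spec T`.**

Proof, assembling the tree: `P₀ ×_{R₀} Spec K = lim_t P₀ ×_{R₀} Spec R₀[t]` over the finite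
subsets `t ⊆ K` (`SubalgApprox.isLimitProdCone`); the closed subscheme `X` is the base change of
its scheme-theoretic image `Y₁ ↪ P₀ ×_{R₀} Spec T₁`, `T₁ = R₀[t]`, for `t` large
(`exists_isPullback_toImage_of_isLocallyNoetherian`, Görtz–Wedhorn I Prop. 10.75 (1)); over the
fraction field `F` of the domain `T₁ ⊆ K` the family `Y₁ ⊗ F → Spec C₀ ⊗ F` is smooth of relative
dimension `n` by fpqc descent from `K` (`smoothOfRelativeDimension_whiskerRight_of_surjective`);
smoothness of relative dimension `n` spreads from `F = Frac T₁` to a localisation `T = T₁[1/s]`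
(`LocApprox.exists_forall_smoothOfRelativeDimension_whiskerRight`, EGA IV₄ 17.7.8 (ii)); the same
for the base `Spec C₀ ⊗ T → Spec T`; finally the `T₁`-relative fibre products are re-read as
`R₀`-relative ones (transitivity of base change).

Everything is proved; no definitions, no named facts.

## References

* [EGAIV3] A. Grothendieck, J. Dieudonné, EGA IV₃, Publ. Math. IHÉS 28 (1966), Thm. 8.8.2,
  Thm. 8.10.5.
* [EGAIV4] EGA IV₄, Publ. Math. IHÉS 32 (1967), Prop. 17.7.8 (ii).
* [GortzWedhorn2020] U. Görtz, T. Wedhorn, *Algebraic Geometry I* (2nd ed., 2020), Prop. 10.75.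
* [MaulikPoonen2012] D. Maulik, B. Poonen, Néron–Severi groups under specialization, Duke Math. J.
  161 (2012), §4.
-/

noncomputable section

universe u

open CategoryTheory CategoryTheory.Limits AlgebraicGeometry TopologicalSpace MonoidalCategory
open Opposite

namespace Literature.AlgebraicGeometry.Limits

open Literature.AlgebraicGeometry.Motives (SchemeOver specOver)

set_option backward.isDefEq.respectTransparency false

/-- Bookkeeping for structure morphisms: the base change `(P ⊗ T).left → (𝟙 ⊗ T).left` of the
morphism `P → 𝟙` to the unit, followed by the isomorphism `(𝟙 ⊗ T).left ≅ T.left`, is the projection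
`(P ⊗ T).left → T.left`; hence one is smooth of relative dimension `n` iff the other is. [folklore] -/
private theorem smoothOfRelativeDimension_toUnit_whiskerRight_iff {Y : Scheme.{u}} (P T : Over Y)
    (n : ℕ) :
    SmoothOfRelativeDimension n (CartesianMonoidalCategory.toUnit P ▷ T).left ↔
      SmoothOfRelativeDimension n (pullback.snd P.hom T.hom) := by
  have h : (CartesianMonoidalCategory.toUnit P ▷ T).left ≫
      pullback.snd (𝟙_ (Over Y)).hom T.hom = pullback.snd P.hom T.hom :=
    Over.whiskerRight_left_snd _
  haveI : IsIso (pullback.snd (𝟙_ (Over Y)).hom T.hom) :=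
    inferInstanceAs (IsIso (pullback.snd (𝟙 Y) T.hom))
  rw [← h, MorphismProperty.cancel_right_of_respectsIso (P := @SmoothOfRelativeDimension n)]

/-- Transitivity of base change, as a cartesian square: for `R₀ → T₁ → T` and an `R₀`-scheme `Q₀`,
`(Q₀ ×_{R₀} Spec T₁) ×_{T₁} Spec T` is a fibre product `Q₀ ×_{R₀} Spec T`. [folklore] -/
private theorem isPullback_snd_snd {R₀ T₁ T : Type u} [CommRing R₀] [CommRing T₁] [CommRing T]
    [Algebra R₀ T₁] [Algebra T₁ T] [Algebra R₀ T] [IsScalarTower R₀ T₁ T] (Q₀ : SchemeOver R₀) :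
    IsPullback
      (pullback.fst (pullback.snd Q₀.hom (specOver R₀ T₁).hom) (specOver T₁ T).hom ≫
        pullback.fst Q₀.hom (specOver R₀ T₁).hom)
      (pullback.snd (pullback.snd Q₀.hom (specOver R₀ T₁).hom) (specOver T₁ T).hom)
      Q₀.hom (specOver R₀ T).hom := by
  have e : (specOver R₀ T).hom = (specOver T₁ T).hom ≫ (specOver R₀ T₁).hom := by
    change Spec.map _ = Spec.map _ ≫ Spec.map _
    rw [← Spec.map_comp, ← CommRingCat.ofHom_comp, ← IsScalarTower.algebraMap_eq]
  rw [e]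
  exact (IsPullback.of_hasPullback (pullback.snd Q₀.hom (specOver R₀ T₁).hom)
    (specOver T₁ T).hom).paste_horiz (IsPullback.of_hasPullback Q₀.hom (specOver R₀ T₁).hom)

/-- **Spreading out an embedded family over a finitely generated subalgebra** (EGA IV₃ 8.8.2 (ii),
8.10.5 (v); IV₄ 17.7.8 (ii); Görtz–Wedhorn I, Prop. 10.75 (1); the family form of the spreading-out
step of Maulik–Poonen 2012, §4). Let `R₀` be a Noetherian ring, `C₀` an `R₀`-algebra of finite
type, `K` a field over `R₀`, `P₀` an `R₀`-scheme of finite type with an `R₀`-morphism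
`p₀ : P₀ → Spec C₀`, and `j : X ↪ P₀ ×_{R₀} Spec K` a closed subscheme such that
`X → Spec C₀ ×_{R₀} Spec K` is smooth of relative dimension `n` and `Spec C₀ ×_{R₀} Spec K → Spec K`
is smooth of relative dimension `d`. Then there are an `R₀`-algebra `T` — a domain of finite type
over `R₀` with an injective `R₀`-algebra map `T → K` (a localisation of a finitely generated
`R₀`-subalgebra of `K`) — a closed subscheme `imm : Y ↪ P₀ ×_{R₀} Spec T` with
`Y → Spec C₀ ×_{R₀} Spec T` smooth of relative dimension `n`, with `Spec C₀ ×_{R₀} Spec T → Spec T`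
smooth of relative dimension `d`, and `πX : X → Y` forming a cartesian square with `j`, `imm` and
the base change `φ : P₀ ×_{R₀} Spec K → P₀ ×_{R₀} Spec T` of `Spec K → Spec T`.
[cite: EGAIV4, Prop. 17.7.8 (ii)] [cite: GortzWedhorn2020, Prop. 10.75 (1)]
[cite: MaulikPoonen2012, §4] -/
theorem exists_stage_closedSubscheme_smoothOfRelativeDimension
    {R₀ : Type u} [CommRing R₀] [IsNoetherianRing R₀]
    {C₀ : Type u} [CommRing C₀] [Algebra R₀ C₀] [Algebra.FiniteType R₀ C₀]
    {K : Type u} [Field K] [Algebra R₀ K]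
    (P₀ : SchemeOver R₀) [LocallyOfFiniteType P₀.hom] [QuasiCompact P₀.hom] [QuasiSeparated P₀.hom]
    (p₀ : P₀ ⟶ specOver R₀ C₀) {n d : ℕ} {X : Scheme.{u}}
    (j : X ⟶ (P₀ ⊗ specOver R₀ K).left) [IsClosedImmersion j]
    [SmoothOfRelativeDimension n (j ≫ (p₀ ▷ specOver R₀ K).left)]
    [SmoothOfRelativeDimension d (pullback.snd (specOver R₀ C₀).hom (specOver R₀ K).hom)] :
    ∃ (T : Type u) (_ : CommRing T) (_ : IsDomain T) (_ : Algebra R₀ T) (_ : Algebra T K)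
      (_ : IsScalarTower R₀ T K) (_ : Algebra.FiniteType R₀ T)
      (Y : Scheme.{u}) (imm : Y ⟶ (P₀ ⊗ specOver R₀ T).left) (_ : IsClosedImmersion imm)
      (πX : X ⟶ Y) (φ : (P₀ ⊗ specOver R₀ K).left ⟶ (P₀ ⊗ specOver R₀ T).left),
      SmoothOfRelativeDimension n (imm ≫ (p₀ ▷ specOver R₀ T).left) ∧
      SmoothOfRelativeDimension d (pullback.snd (specOver R₀ C₀).hom (specOver R₀ T).hom) ∧
      φ ≫ pullback.fst P₀.hom (specOver R₀ T).hom = pullback.fst P₀.hom (specOver R₀ K).hom ∧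
      φ ≫ pullback.snd P₀.hom (specOver R₀ T).hom =
        pullback.snd P₀.hom (specOver R₀ K).hom ≫ Spec.map (CommRingCat.ofHom (algebraMap T K)) ∧
      IsPullback j πX φ imm := by
  classical
  -- 0. the cone point `P₀ ⊗ Spec K` is locally Noetherian
  haveI : IsLocallyNoetherian (specOver R₀ K).left :=
    (isLocallyNoetherian_Spec (R := CommRingCat.of K)).mpr (inferInstanceAs (IsNoetherianRing K))
  haveI : IsLocallyNoetherian (SubalgApprox.prodCone R₀ K ∅ P₀).pt :=
    LocallyOfFiniteType.isLocallyNoetherian (pullback.snd P₀.hom (specOver R₀ K).hom)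
  -- 1. descent of the closed subscheme to a stage `T₁ = R₀[t]`
  obtain ⟨i, hi⟩ := exists_isPullback_toImage_of_isLocallyNoetherian
    (SubalgApprox.prodDiagram R₀ K ∅ P₀) (SubalgApprox.prodCone R₀ K ∅ P₀)
    (SubalgApprox.isLimitProdCone R₀ K ∅ P₀) j
  have H₁ := hi i (𝟙 i)
  -- the stage ring and the leg `Spec K → Spec T₁`
  let T₁ : Type u := ↥(SubalgApprox.sub R₀ K i.unop.1)
  let leg : specOver R₀ K ⟶ specOver R₀ T₁ := (SubalgApprox.baseCone R₀ K ∅).π.app i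
  have hleg : leg.left = (specOver T₁ K).hom := rfl
  have hinj₁ : Function.Injective (algebraMap T₁ K) := Subtype.val_injective
  haveI : IsDomain T₁ := inferInstance
  haveI : Algebra.FiniteType R₀ T₁ := inferInstance
  haveI : IsNoetherianRing T₁ := Algebra.FiniteType.isNoetherianRing R₀ T₁
  -- the model `Y₁ ↪ P₀ ⊗ Spec T₁` and the cartesian square
  set Y₁ : Scheme.{u} := (j ≫ (SubalgApprox.prodCone R₀ K ∅ P₀).π.app i).image with hY₁
  set π₁ : X ⟶ Y₁ := (j ≫ (SubalgApprox.prodCone R₀ K ∅ P₀).π.app i).toImage with hπ₁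
  set imm₁ : Y₁ ⟶ (P₀ ⊗ specOver R₀ T₁).left :=
    (j ≫ (SubalgApprox.prodCone R₀ K ∅ P₀).π.app i).imageι with himm₁
  have H₁' : IsPullback j π₁ (P₀ ◁ leg).left imm₁ := H₁
  -- 2. the stage as a base: `T₁`-schemes
  let PT : SchemeOver T₁ := Over.mk (pullback.snd P₀.hom (specOver R₀ T₁).hom)
  let QT : SchemeOver T₁ := Over.mk (pullback.snd (specOver R₀ C₀).hom (specOver R₀ T₁).hom)
  let YT : SchemeOver T₁ := Over.mk (imm₁ ≫ pullback.snd P₀.hom (specOver R₀ T₁).hom)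
  let ι₁ : YT ⟶ PT := Over.homMk imm₁ rfl
  let pT : PT ⟶ QT := Over.homMk (p₀ ▷ specOver R₀ T₁).left (Over.whiskerRight_left_snd p₀)
  let f₁ : YT ⟶ QT := ι₁ ≫ pT
  have hf₁ : f₁.left = imm₁ ≫ (p₀ ▷ specOver R₀ T₁).left := rfl
  -- `X = Y₁ ×_{T₁} Spec K` and `Q₀ ⊗ K = (Q₀ ⊗ T₁) ×_{T₁} Spec K`
  have WL := SubalgApprox.isPullback_whiskerLeft_left P₀ leg
  have WLQ := SubalgApprox.isPullback_whiskerLeft_left (specOver R₀ C₀) leg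
  have HX : IsPullback π₁ (j ≫ pullback.snd P₀.hom (specOver R₀ K).hom) YT.hom
      (specOver T₁ K).hom := H₁'.flip.paste_vert WL
  have WLQ' : IsPullback ((specOver R₀ C₀) ◁ leg).left
      (pullback.snd (specOver R₀ C₀).hom (specOver R₀ K).hom) QT.hom (specOver T₁ K).hom := WLQ
  let α : X ≅ (YT ⊗ specOver T₁ K).left := HX.isoPullback
  let β : (specOver R₀ C₀ ⊗ specOver R₀ K).left ≅ (QT ⊗ specOver T₁ K).left := WLQ'.isoPullback
  have hαfst : α.inv ≫ π₁ = pullback.fst YT.hom (specOver T₁ K).hom := HX.isoPullback_inv_fst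
  have hαsnd : α.inv ≫ (j ≫ pullback.snd P₀.hom (specOver R₀ K).hom) =
      pullback.snd YT.hom (specOver T₁ K).hom := HX.isoPullback_inv_snd
  have hβfst : β.hom ≫ pullback.fst QT.hom (specOver T₁ K).hom = ((specOver R₀ C₀) ◁ leg).left :=
    WLQ'.isoPullback_hom_fst
  have hβsnd : β.hom ≫ pullback.snd QT.hom (specOver T₁ K).hom =
      pullback.snd (specOver R₀ C₀).hom (specOver R₀ K).hom := WLQ'.isoPullback_hom_snd
  have hβinv : β.inv ≫ pullback.snd (specOver R₀ C₀).hom (specOver R₀ K).hom =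
      pullback.snd QT.hom (specOver T₁ K).hom := WLQ'.isoPullback_inv_snd
  -- the family over `K`, read over `T₁`
  have hcomm : (f₁ ▷ specOver T₁ K).left =
      α.inv ≫ (j ≫ (p₀ ▷ specOver R₀ K).left) ≫ β.hom := by
    apply pullback.hom_ext
    · rw [Over.whiskerRight_left_fst, Category.assoc, Category.assoc, Category.assoc, hβfst]
      have e1 : (p₀ ▷ specOver R₀ K).left ≫ ((specOver R₀ C₀) ◁ leg).left =
          (P₀ ◁ leg).left ≫ (p₀ ▷ specOver R₀ T₁).left := by
        rw [← Over.comp_left, ← Over.comp_left, whisker_exchange]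
      rw [e1, ← Category.assoc j, H₁'.w, Category.assoc, ← hf₁, ← Category.assoc α.inv π₁, hαfst]
    · rw [Over.whiskerRight_left_snd, Category.assoc, Category.assoc, Category.assoc, hβsnd,
        Over.whiskerRight_left_snd, hαsnd]
  haveI hK : SmoothOfRelativeDimension n (f₁ ▷ specOver T₁ K).left := by
    rw [hcomm, MorphismProperty.cancel_left_of_respectsIso (P := @SmoothOfRelativeDimension n),
      MorphismProperty.cancel_right_of_respectsIso (P := @SmoothOfRelativeDimension n)]
    infer_instance
  haveI hKb : SmoothOfRelativeDimension d
      (CartesianMonoidalCategory.toUnit QT ▷ specOver T₁ K).left := by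
    rw [smoothOfRelativeDimension_toUnit_whiskerRight_iff, ← hβinv,
      MorphismProperty.cancel_left_of_respectsIso (P := @SmoothOfRelativeDimension d)]
    infer_instance
  -- 3. descent to the fraction field `F` of `T₁`
  let ψ : FractionRing T₁ →+* K := IsFractionRing.lift (g := algebraMap T₁ K) hinj₁
  letI : Algebra (FractionRing T₁) K := ψ.toAlgebra
  haveI : IsScalarTower T₁ (FractionRing T₁) K := IsScalarTower.of_algebraMap_eq fun r =>
    (IsFractionRing.lift_algebraMap (g := algebraMap T₁ K) hinj₁ r).symm
  let a : specOver T₁ K ⟶ specOver T₁ (FractionRing T₁) :=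
    Over.homMk (Spec.map (CommRingCat.ofHom (algebraMap (FractionRing T₁) K))) (by
      change Spec.map _ ≫ Spec.map _ = Spec.map _
      rw [← Spec.map_comp, ← CommRingCat.ofHom_comp, ← IsScalarTower.algebraMap_eq])
  obtain ⟨⟨ha₁, ha₂⟩, ha₃⟩ :=
    Literature.AlgebraicGeometry.Motives.ProperDescent.fpqc_specMap (FractionRing T₁) K
  haveI : Surjective a.left := ha₁
  haveI : Flat a.left := ha₂
  haveI : QuasiCompact a.left := ha₃
  haveI hF : SmoothOfRelativeDimension n (f₁ ▷ specOver T₁ (FractionRing T₁)).left :=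
    smoothOfRelativeDimension_whiskerRight_of_surjective f₁ _ a n
  haveI hFb : SmoothOfRelativeDimension d
      (CartesianMonoidalCategory.toUnit QT ▷ specOver T₁ (FractionRing T₁)).left :=
    smoothOfRelativeDimension_whiskerRight_of_surjective _ _ a d
  -- 4. spreading out from `F = Frac T₁` to a localisation `T = T₁[1/s]` (EGA IV₄ 17.7.8)
  haveI : QuasiCompact YT.hom := inferInstanceAs (QuasiCompact (imm₁ ≫ _))
  haveI : QuasiCompact (specOver R₀ C₀).hom := by
    change QuasiCompact (Spec.map _); infer_instance
  haveI : QuasiCompact QT.hom :=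
    inferInstanceAs (QuasiCompact (pullback.snd (specOver R₀ C₀).hom (specOver R₀ T₁).hom))
  haveI : IsLocallyNoetherian (specOver R₀ T₁).left :=
    (isLocallyNoetherian_Spec (R := CommRingCat.of T₁)).mpr (inferInstanceAs (IsNoetherianRing T₁))
  haveI : LocallyOfFiniteType (specOver R₀ C₀).hom := by
    change LocallyOfFiniteType (Spec.map _)
    rw [HasRingHomProperty.Spec_iff (P := @LocallyOfFiniteType)]
    exact RingHom.finiteType_algebraMap.mpr inferInstance
  haveI : IsLocallyNoetherian QT.left :=
    LocallyOfFiniteType.isLocallyNoetherian (pullback.snd (specOver R₀ C₀).hom (specOver R₀ T₁).hom)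
  haveI : LocallyOfFiniteType p₀.left := by
    have : LocallyOfFiniteType (p₀.left ≫ (specOver R₀ C₀).hom) := by
      rw [Over.w p₀]; infer_instance
    exact locallyOfFiniteType_of_comp p₀.left (specOver R₀ C₀).hom
  haveI : LocallyOfFiniteType (p₀ ▷ specOver R₀ T₁).left :=
    MorphismProperty.of_isPullback (P := @LocallyOfFiniteType)
      (LocApprox.isPullback_whiskerRight_left p₀ (specOver R₀ T₁)).flip inferInstance
  haveI : LocallyOfFiniteType f₁.left := by rw [hf₁]; infer_instance
  haveI : LocallyOfFinitePresentation f₁.left :=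
    LocallyOfFinitePresentation.iff_locallyOfFiniteType.mpr inferInstance
  haveI : LocallyOfFinitePresentation (CartesianMonoidalCategory.toUnit QT).left := by
    change LocallyOfFinitePresentation (pullback.snd (specOver R₀ C₀).hom (specOver R₀ T₁).hom)
    exact LocallyOfFinitePresentation.iff_locallyOfFiniteType.mpr inferInstance
  obtain ⟨s₁, hs₁, Hs₁⟩ := LocApprox.exists_forall_smoothOfRelativeDimension_whiskerRight
    (nonZeroDivisors T₁) (FractionRing T₁) f₁ n
  obtain ⟨s₂, hs₂, Hs₂⟩ := LocApprox.exists_forall_smoothOfRelativeDimension_whiskerRight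
    (nonZeroDivisors T₁) (FractionRing T₁) (CartesianMonoidalCategory.toUnit QT) d
  have hs₁0 : s₁ ≠ 0 := nonZeroDivisors.ne_zero hs₁
  have hs₂0 : s₂ ≠ 0 := nonZeroDivisors.ne_zero hs₂
  have hs0 : s₁ * s₂ ≠ 0 := mul_ne_zero hs₁0 hs₂0
  let Tl : Type u := Localization.Away (s₁ * s₂)
  haveI : IsDomain Tl := IsLocalization.isDomain_localization (M := Submonoid.powers (s₁ * s₂))
    (powers_le_nonZeroDivisors_of_noZeroDivisors hs0)
  haveI : Algebra.FinitePresentation T₁ Tl := IsLocalization.Away.finitePresentation (s₁ * s₂)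
  have hTft : Algebra.FiniteType R₀ Tl :=
    Algebra.FiniteType.trans (inferInstance : Algebra.FiniteType R₀ T₁) inferInstance
  have hunit : IsUnit (algebraMap T₁ K (s₁ * s₂)) :=
    Ne.isUnit (fun h => hs0 (hinj₁ (by rw [h, map_zero])))
  letI algTK : Algebra Tl K := (IsLocalization.Away.lift (s₁ * s₂) hunit).toAlgebra
  haveI : IsScalarTower T₁ Tl K := IsScalarTower.of_algebraMap_eq fun r =>
    (IsLocalization.Away.lift_eq (s₁ * s₂) hunit r).symm
  haveI : IsScalarTower R₀ Tl K := IsScalarTower.of_algebraMap_eq fun r => by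
    rw [IsScalarTower.algebraMap_apply R₀ T₁ Tl, ← IsScalarTower.algebraMap_apply T₁ Tl K,
      ← IsScalarTower.algebraMap_apply R₀ T₁ K]
  have hsml : SmoothOfRelativeDimension n (f₁ ▷ specOver T₁ Tl).left :=
    Hs₁ (s₁ * s₂) (dvd_mul_right s₁ s₂) Tl
  have hsmbl : SmoothOfRelativeDimension d (pullback.snd QT.hom (specOver T₁ Tl).hom) :=
    (smoothOfRelativeDimension_toUnit_whiskerRight_iff QT (specOver T₁ Tl) d).mp
      (Hs₂ (s₁ * s₂) (dvd_mul_left s₂ s₁) Tl)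
  -- from here on the localisation is treated as an abstract `R₀`-algebra `T` (this keeps
  -- definitional unfolding away from the internals of `Localization`)
  obtain ⟨T, _, _, _, _, _, algTK, _, _, hTft, hsm, hsmb⟩ :
      ∃ (T : Type u) (_ : CommRing T) (_ : IsDomain T) (_ : Algebra R₀ T) (_ : Algebra T₁ T)
        (_ : IsScalarTower R₀ T₁ T) (_ : Algebra T K) (_ : IsScalarTower T₁ T K)
        (_ : IsScalarTower R₀ T K), Algebra.FiniteType R₀ T ∧
        SmoothOfRelativeDimension n (f₁ ▷ specOver T₁ T).left ∧
        SmoothOfRelativeDimension d (pullback.snd QT.hom (specOver T₁ T).hom) :=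
    ⟨Tl, inferInstance, inferInstance, inferInstance, inferInstance, inferInstance, algTK,
      inferInstance, inferInstance, hTft, hsml, hsmbl⟩
  -- 5. re-reading the `T₁`-relative fibre products over `R₀`
  have SqQ : IsPullback
      (pullback.fst QT.hom (specOver T₁ T).hom ≫ pullback.fst (specOver R₀ C₀).hom (specOver R₀ T₁).hom)
      (pullback.snd QT.hom (specOver T₁ T).hom) (specOver R₀ C₀).hom (specOver R₀ T).hom :=
    isPullback_snd_snd (T₁ := T₁) (T := T) (specOver R₀ C₀)
  have SqP : IsPullback
      (pullback.fst PT.hom (specOver T₁ T).hom ≫ pullback.fst P₀.hom (specOver R₀ T₁).hom)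
      (pullback.snd PT.hom (specOver T₁ T).hom) P₀.hom (specOver R₀ T).hom :=
    isPullback_snd_snd (T₁ := T₁) (T := T) P₀
  let γ : (QT ⊗ specOver T₁ T).left ≅ (specOver R₀ C₀ ⊗ specOver R₀ T).left :=
    SqQ.isoIsPullback _ _ (IsPullback.of_hasPullback (specOver R₀ C₀).hom (specOver R₀ T).hom)
  let γP : (PT ⊗ specOver T₁ T).left ≅ (P₀ ⊗ specOver R₀ T).left :=
    SqP.isoIsPullback _ _ (IsPullback.of_hasPullback P₀.hom (specOver R₀ T).hom)
  have hγfst : γ.hom ≫ pullback.fst (specOver R₀ C₀).hom (specOver R₀ T).hom =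
      pullback.fst QT.hom (specOver T₁ T).hom ≫
        pullback.fst (specOver R₀ C₀).hom (specOver R₀ T₁).hom :=
    SqQ.isoIsPullback_hom_fst _ _ _
  have hγsnd : γ.hom ≫ pullback.snd (specOver R₀ C₀).hom (specOver R₀ T).hom =
      pullback.snd QT.hom (specOver T₁ T).hom :=
    SqQ.isoIsPullback_hom_snd _ _ _
  have hγPfst : γP.hom ≫ pullback.fst P₀.hom (specOver R₀ T).hom =
      pullback.fst PT.hom (specOver T₁ T).hom ≫ pullback.fst P₀.hom (specOver R₀ T₁).hom :=
    SqP.isoIsPullback_hom_fst _ _ _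
  have hγPsnd : γP.hom ≫ pullback.snd P₀.hom (specOver R₀ T).hom =
      pullback.snd PT.hom (specOver T₁ T).hom :=
    SqP.isoIsPullback_hom_snd _ _ _
  -- the model `Y ↪ P₀ ⊗ Spec T`
  have hι₁ : ι₁.left = imm₁ := rfl
  obtain ⟨imm, himm_def⟩ : ∃ imm : (YT ⊗ specOver T₁ T).left ⟶ (P₀ ⊗ specOver R₀ T).left,
      imm = (ι₁ ▷ specOver T₁ T).left ≫ γP.hom := ⟨_, rfl⟩
  haveI : IsClosedImmersion (ι₁ ▷ specOver T₁ T).left :=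
    MorphismProperty.of_isPullback (P := @IsClosedImmersion)
      (LocApprox.isPullback_whiskerRight_left ι₁ (specOver T₁ T)).flip
      (inferInstanceAs (IsClosedImmersion imm₁))
  haveI : IsClosedImmersion imm := by rw [himm_def]; infer_instance
  have himm : imm ≫ (p₀ ▷ specOver R₀ T).left = (f₁ ▷ specOver T₁ T).left ≫ γ.hom := by
    rw [himm_def]
    apply pullback.hom_ext
    · simp only [Category.assoc, Over.whiskerRight_left_fst, hγfst, reassoc_of% hγPfst,
        Over.whiskerRight_left_fst_assoc, hf₁, hι₁]
    · simp only [Category.assoc, Over.whiskerRight_left_snd, hγsnd, hγPsnd]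
  have hYn : SmoothOfRelativeDimension n (imm ≫ (p₀ ▷ specOver R₀ T).left) := by
    rw [himm, MorphismProperty.cancel_right_of_respectsIso (P := @SmoothOfRelativeDimension n)]
    exact hsm
  have hYd : SmoothOfRelativeDimension d
      (pullback.snd (specOver R₀ C₀).hom (specOver R₀ T).hom) := by
    rw [(Iso.eq_inv_comp γ).mpr hγsnd,
      MorphismProperty.cancel_left_of_respectsIso (P := @SmoothOfRelativeDimension d)]
    exact hsmb
  -- 6. the legs `Spec K → Spec T → Spec T₁` and the cartesian square
  let b : specOver R₀ K ⟶ specOver R₀ T :=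
    Over.homMk (Spec.map (CommRingCat.ofHom (algebraMap T K))) (by
      change Spec.map _ ≫ Spec.map _ = Spec.map _
      rw [← Spec.map_comp, ← CommRingCat.ofHom_comp, ← IsScalarTower.algebraMap_eq])
  let bT : specOver T₁ K ⟶ specOver T₁ T :=
    Over.homMk (Spec.map (CommRingCat.ofHom (algebraMap T K))) (by
      change Spec.map _ ≫ Spec.map _ = Spec.map _
      rw [← Spec.map_comp, ← CommRingCat.ofHom_comp, ← IsScalarTower.algebraMap_eq])
  let c : specOver R₀ T ⟶ specOver R₀ T₁ :=
    Over.homMk (Spec.map (CommRingCat.ofHom (algebraMap T₁ T))) (by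
      change Spec.map _ ≫ Spec.map _ = Spec.map _
      rw [← Spec.map_comp, ← CommRingCat.ofHom_comp, ← IsScalarTower.algebraMap_eq])
  have hb : b.left = Spec.map (CommRingCat.ofHom (algebraMap T K)) := rfl
  have hbT : bT.left = Spec.map (CommRingCat.ofHom (algebraMap T K)) := rfl
  have hbc : b ≫ c = leg := by
    ext : 1
    rw [Over.comp_left, hleg]
    change Spec.map _ ≫ Spec.map _ = Spec.map _
    rw [← Spec.map_comp, ← CommRingCat.ofHom_comp, ← IsScalarTower.algebraMap_eq]
  have hφc : (P₀ ◁ b).left ≫ (P₀ ◁ c).left = (P₀ ◁ leg).left := by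
    rw [← Over.comp_left, ← MonoidalCategory.whiskerLeft_comp, hbc]
  -- `Y = Y₁ ×_{P₀ ⊗ T₁} (P₀ ⊗ T)`
  have hγc : γP.hom ≫ (P₀ ◁ c).left = pullback.fst PT.hom (specOver T₁ T).hom := by
    apply pullback.hom_ext
    · simp only [Category.assoc, Over.whiskerLeft_left_fst, hγPfst]
    · simp only [Category.assoc, Over.whiskerLeft_left_snd, reassoc_of% hγPsnd]
      exact (pullback.condition (f := PT.hom) (g := (specOver T₁ T).hom)).symm
  have SqY : IsPullback (pullback.fst YT.hom (specOver T₁ T).hom) imm imm₁ (P₀ ◁ c).left := by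
    have s1 := (LocApprox.isPullback_whiskerRight_left ι₁ (specOver T₁ T)).flip
    have s2 : IsPullback (pullback.fst PT.hom (specOver T₁ T).hom) γP.hom (𝟙 _) (P₀ ◁ c).left :=
      IsPullback.of_vert_isIso ⟨by rw [Category.comp_id, hγc]⟩
    have s := s1.paste_vert s2
    rw [Category.comp_id, hι₁, ← himm_def] at s
    exact s
  -- `πX : X → Y`
  have hαhom_fst : α.hom ≫ pullback.fst YT.hom (specOver T₁ K).hom = π₁ := HX.isoPullback_hom_fst
  have hαhom_snd : α.hom ≫ pullback.snd YT.hom (specOver T₁ K).hom =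
      j ≫ pullback.snd P₀.hom (specOver R₀ K).hom := HX.isoPullback_hom_snd
  obtain ⟨πX, hπX_def⟩ : ∃ πX : X ⟶ (YT ⊗ specOver T₁ T).left, πX = α.hom ≫ (YT ◁ bT).left :=
    ⟨_, rfl⟩
  have hπX : πX ≫ pullback.fst YT.hom (specOver T₁ T).hom = π₁ := by
    rw [hπX_def, Category.assoc, Over.whiskerLeft_left_fst, hαhom_fst]
  have hWRf := Over.whiskerRight_left_fst (R := specOver T₁ T) ι₁
  have hWRs := Over.whiskerRight_left_snd (R := specOver T₁ T) ι₁
  have hWLf := Over.whiskerLeft_left_fst (R := YT) bT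
  have hWLs := Over.whiskerLeft_left_snd (R := YT) bT
  have hPbf := Over.whiskerLeft_left_fst (R := P₀) b
  have hPbs := Over.whiskerLeft_left_snd (R := P₀) b
  have hPlf := Over.whiskerLeft_left_fst (R := P₀) leg
  have hp : πX ≫ imm = j ≫ (P₀ ◁ b).left := by
    rw [hπX_def, himm_def]
    apply pullback.hom_ext
    · simp only [Category.assoc]
      rw [hγPfst, ← Category.assoc (ι₁ ▷ specOver T₁ T).left, hWRf, Category.assoc,
        ← Category.assoc (YT ◁ bT).left, hWLf, ← Category.assoc α.hom, hαhom_fst, hι₁,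
        ← Category.assoc π₁, ← H₁'.w, Category.assoc, hPlf, hPbf]
    · simp only [Category.assoc]
      rw [hγPsnd, hWRs, hWLs, ← Category.assoc α.hom, hαhom_snd, hPbs, Category.assoc, hb, hbT]
  have Hfinal : IsPullback πX j imm (P₀ ◁ b).left := by
    refine IsPullback.of_right ?_ hp SqY
    rw [hπX, hφc]
    exact H₁'.flip
  -- 7. assembly
  exact ⟨T, inferInstance, inferInstance, inferInstance, algTK, inferInstance, hTft,
    (YT ⊗ specOver T₁ T).left, imm, inferInstance, πX, (P₀ ◁ b).left, hYn, hYd,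
    Over.whiskerLeft_left_fst (R := P₀) b, Over.whiskerLeft_left_snd (R := P₀) b, Hfinal.flip⟩

end Literature.AlgebraicGeometry.Limits

end
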